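import Summits.Parity.GeneralizedHardyLittlewood.Theorems.BeyondDiagonalBeatsQuarter.OffDiagCoreLedgerSplit
import Summits.Parity.GeneralizedHardyLittlewood.Theorems.BeyondDiagonalBeatsQuarter.OffDiagCoreLedgerTail
import HarnessLib

/-!
# Route `PrimeLevelFamEdge`, crux K_B (stmt-Parity-20343), line `diagonal_kernel_split` rev 4, plan Ω,
# worker key K2 `OffDiagCoreLedger`: **the trivial size of EXACTLY the finite dual core —
# `|offDiagCore Hf Δ′ q| ≤ q^{(5/4)(Δ′−1) + 2ε₀ + ε}·mainScaleReal Δ′ q` for every coordinatewise-admissible `Hf`**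

Lead key K2 (2026-08-28): the kernel number later savings are quoted against. Assembly of
* `OffDiagCoreLedgerSplit.abs_offDiagCore_le_ledger_add_tail` — `|core| ≤ (4πq̂/q)(LEDGER(Hf,H₂f) + TAIL₂(H₂f))`;
* `OffDiagDualLedgerMainScale.dualLedgerTotal_scales_le` — `(4πq̂/q)·LEDGER ≤ q^{(5/4)(Δ′−1)+2ε₀+ε/2}·ms` for
  coordinatewise-admissible heights (`coreHeights_admissible`: the pair `(Hf, H₂f)`,
  `H₂f = ⌈q(r+1)·D₂·q^{ε₀}/(2π)⌉`, is admissible with `Λ₀* = max(Λ₀, 2/π)` by `truncHeight_snd_le`);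
* `OffDiagCoreLedgerTail.exists_boxTail_snd_le` (L2 with `k = ⌈74/ε₀⌉ + 2`) and the count `coreTail_count_le`
  (`q⁷` layers, `⌊q̂^{Δ′}⌋ ≤ q` twice, `|c_lc_m| ≤ 1`, `τ ≤ q` twice, `#nearBoxes ≤ 121q²`, prefactor `≤ 4π`):
  `(4πq̂/q)·TAIL₂ ≤ 484π𝓚_k·q^{74}·q^{−kε₀} ≤ 484π𝓚_k ≤ ms` eventually (`exists_qhat_rpow_le_mul_mainScaleReal`).
Main theorem **`abs_offDiagCore_le`**: for `Λ₀ ≥ 0`, `0 < ε₀ ≤ 1`, `ε > 0` there is `q₀` such that for all primes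
`q ≥ q₀`, all `Δ′ ∈ (1,2]` and all height functions `Hf` with
`Hf q d₁ d₂ α β c i ≤ Λ₀·qc(1 + 4π√(αβ2^{i₁}2^{i₂})/(qc))q^{ε₀}/2^{i₁} + 1` (all indices):
`|offDiagCore Hf Δ′ q| ≤ q^{(5/4)(Δ′−1)+2ε₀+ε}·mainScaleReal Δ′ q` — the trivial exponent `κ₀ = 5/4` for the lead's
object itself. `Hf` is a parameter: K1's `Hf_ε₀ = ⌈q c D₁ q^{ε₀}/(2π)⌉` qualifies with `Λ₀ = 2/π`
(`OffDiagDualLedgerMainScale.truncHeight_fst_le`, `natCeil_le_add_one`). Bookkeeping; nothing about the heart.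
Helper (`--supports stmt-Parity-20343`); standard axioms.
«The programme SEARCHES and TYPES; no claim about Landau–Siegel zeros, Theorems 1–2 of arXiv:2211.02515 or
a repaired Margin232 until a kernel theorem says so.»
-/

noncomputable section

open Finset Polynomial
open scoped Real

namespace Summit.Parity.GeneralizedHardyLittlewood.Theorems.BeyondDiagonalBeatsQuarter.OffDiag

open Literature.NumberTheory.LFunctions Literature.NumberTheory.LFunctions.KMV2000
open Literature.NumberTheory.Sieve.FriedlanderIwaniecPrimes (fourier2)
open PeterssonSplit (nearBoxes two_pi_mul_qhat_sq qhat_sq_le)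

/-! ### §3. Counting the finite index set; the main theorem -/

/-- **Counting.** If every weighted box tail of the finite dual core is `≤ B` (`B ≥ 0`), then for `q ≥ 40`,
`0 < Δ′ ≤ 2`: `(4πq̂/q)·TAIL₂ ≤ 4π·121·q^{13}·B` (`q⁷` layers, `⌊q̂^{Δ′}⌋ ≤ q` twice, `|c_lc_m| ≤ 1`,
`τ(l), τ(m) ≤ q`, `#nearBoxes ≤ 121 log²q ≤ 121q²`, `4πq̂/q ≤ 4π`).
[cite: KowalskiMichelVanderKam2000, (21)–(23) p. 12 — derivation] -/
theorem coreTail_count_le {q : ℕ} [NeZero q] (hq : 40 ≤ q) {Δ' : ℝ} (h0 : 0 < Δ') (h2 : Δ' ≤ 2)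
    (H₂f : ℕ → ℕ → ℕ → ℕ → ℕ → ℕ → ℕ × ℕ → ℕ) {B : ℝ} (hB : 0 ≤ B)
    (hbox : ∀ r ∈ Finset.range (q ^ 7), ∀ l ∈ Finset.Icc 1 ⌊qhat q ^ Δ'⌋₊, ∀ m ∈ Finset.Icc 1 ⌊qhat q ^ Δ'⌋₊,
      ∀ d₁ ∈ l.divisors, ∀ d₂ ∈ m.divisors, ∀ i ∈ nearBoxes q d₁ d₂ (Real.log q ^ 4),
        ((q * (r + 1) : ℕ) : ℝ) * ∑' h : ℤ × ℤ,
          (if (H₂f q d₁ d₂ (l / d₁) (m / d₂) (r + 1) i : ℤ) < |h.2| then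
            ‖fourier2 (boxWeight q d₁ d₂ (l / d₁) (m / d₂) (r + 1) i) (h.1 / (q * (r + 1) : ℕ))
              (h.2 / (q * (r + 1) : ℕ))‖ else 0) ≤ B) :
    4 * π * qhat q / q *
      ∑ r ∈ Finset.range (q ^ 7), ∑ l ∈ Finset.Icc 1 ⌊qhat q ^ Δ'⌋₊, ∑ m ∈ Finset.Icc 1 ⌊qhat q ^ Δ'⌋₊,
        |mollifierCoeff (X ^ 2) (qhat q ^ Δ') l * mollifierCoeff (X ^ 2) (qhat q ^ Δ') m| *
          ∑ d₁ ∈ l.divisors, ∑ d₂ ∈ m.divisors, ∑ i ∈ nearBoxes q d₁ d₂ (Real.log q ^ 4),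
            ((q * (r + 1) : ℕ) : ℝ) * ∑' h : ℤ × ℤ,
              (if (H₂f q d₁ d₂ (l / d₁) (m / d₂) (r + 1) i : ℤ) < |h.2| then
                ‖fourier2 (boxWeight q d₁ d₂ (l / d₁) (m / d₂) (r + 1) i) (h.1 / (q * (r + 1) : ℕ))
                  (h.2 / (q * (r + 1) : ℕ))‖ else 0) ≤
      4 * π * (121 * (q : ℝ) ^ 13 * B) := by
  set s : ℝ := qhat q with hs
  set L : ℝ := Real.log q with hL
  set M : ℝ := s ^ Δ' with hM
  have hs1 : 1 < s := one_lt_qhat hq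
  have hs0 : 0 < s := lt_trans one_pos hs1
  have hq0 : (0 : ℝ) < q := by exact_mod_cast (show 0 < q by omega)
  have hq1 : (1 : ℝ) ≤ q := by exact_mod_cast (show 1 ≤ q by omega)
  have hL0 : 0 < L := lt_of_lt_of_le one_pos (one_le_log hq)
  have hL_le_q : L ≤ (q : ℝ) := (Real.log_le_sub_one_of_pos hq0).trans (by linarith)
  have hsq : s ^ 2 ≤ (q : ℝ) := qhat_sq_le q
  have hM1 : 1 < M := Real.one_lt_rpow hs1 h0
  have hMq : M ≤ (q : ℝ) := by
    calc M ≤ s ^ (2 : ℝ) := Real.rpow_le_rpow_of_exponent_le hs1.le h2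
      _ = s ^ 2 := by rw [show (2 : ℝ) = (2 : ℕ) by norm_num, Real.rpow_natCast]
      _ ≤ q := hsq
  have hfloor : (⌊M⌋₊ : ℝ) ≤ q := (Nat.floor_le (by positivity)).trans hMq
  -- prefactor
  have hpre : 4 * π * s / q ≤ 4 * π := by
    rw [div_le_iff₀ hq0]
    have : s ≤ (q : ℝ) := le_trans (by nlinarith) hsq
    nlinarith [Real.pi_pos]
  -- |c_l c_m| ≤ 1
  have hX : ∀ t ∈ Set.Icc (0 : ℝ) 1, |(X ^ 2 : ℝ[X]).eval t| ≤ 1 := by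
    intro t ht
    rw [eval_pow, eval_X, abs_pow, abs_of_nonneg ht.1]
    exact pow_le_one₀ ht.1 ht.2
  have hcoef : ∀ l ∈ Finset.Icc 1 ⌊M⌋₊, |mollifierCoeff (X ^ 2) M l| ≤ 1 := by
    intro l hl
    have hl1 : (1 : ℝ) ≤ l := by exact_mod_cast (Finset.mem_Icc.mp hl).1
    have h := KMV2000.abs_mollifierCoeff_le hX hM1 hl
    rw [← KMV2000.mollifierCoeff] at h
    calc _ ≤ 1 * (l : ℝ) ^ (-(1 / 2 : ℝ)) := h
      _ ≤ 1 * 1 := by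
          gcongr
          exact Real.rpow_le_one_of_one_le_of_nonpos hl1 (by norm_num)
      _ = 1 := one_mul _
  -- near boxes
  have hnear : ∀ {d₁ d₂ : ℕ}, 1 ≤ d₁ → 1 ≤ d₂ →
      ((nearBoxes q d₁ d₂ (L ^ 4)).card : ℝ) ≤ 121 * (q : ℝ) ^ 2 := by
    intro d₁ d₂ hd₁ hd₂
    have hc := card_nearBoxes_le (q := q) (d₁ := d₁) (d₂ := d₂) (Nat.mul_pos hd₁ hd₂) (L ^ 4)
    have hN := natLog_floor_sq_le hq
    rw [← hs, ← hL] at hN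
    calc ((nearBoxes q d₁ d₂ (L ^ 4)).card : ℝ) ≤ (((Nat.log 2 ⌊4 * s ^ 2 * L ^ 4⌋₊ + 1) ^ 2 : ℕ) : ℝ) := by
          exact_mod_cast hc
      _ ≤ 121 * L ^ 2 := hN
      _ ≤ 121 * (q : ℝ) ^ 2 := by gcongr
  -- the nested count
  have hinner : ∀ r ∈ Finset.range (q ^ 7), ∀ l ∈ Finset.Icc 1 ⌊M⌋₊, ∀ m ∈ Finset.Icc 1 ⌊M⌋₊,
      |mollifierCoeff (X ^ 2) M l * mollifierCoeff (X ^ 2) M m| *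
          ∑ d₁ ∈ l.divisors, ∑ d₂ ∈ m.divisors, ∑ i ∈ nearBoxes q d₁ d₂ (L ^ 4),
            ((q * (r + 1) : ℕ) : ℝ) * ∑' h : ℤ × ℤ,
              (if (H₂f q d₁ d₂ (l / d₁) (m / d₂) (r + 1) i : ℤ) < |h.2| then
                ‖fourier2 (boxWeight q d₁ d₂ (l / d₁) (m / d₂) (r + 1) i) (h.1 / (q * (r + 1) : ℕ))
                  (h.2 / (q * (r + 1) : ℕ))‖ else 0) ≤ (q : ℝ) * ((q : ℝ) * (121 * (q : ℝ) ^ 2 * B)) := by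
    intro r hr l hl m hm
    have hl1 : 1 ≤ l := (Finset.mem_Icc.mp hl).1
    have hm1 : 1 ≤ m := (Finset.mem_Icc.mp hm).1
    have hlq : (l : ℝ) ≤ q := le_trans (by exact_mod_cast (Finset.mem_Icc.mp hl).2) hfloor
    have hmq : (m : ℝ) ≤ q := le_trans (by exact_mod_cast (Finset.mem_Icc.mp hm).2) hfloor
    have hcc : |mollifierCoeff (X ^ 2) M l * mollifierCoeff (X ^ 2) M m| ≤ 1 := by
      rw [abs_mul]
      calc _ ≤ 1 * 1 := mul_le_mul (hcoef l hl) (hcoef m hm) (abs_nonneg _) zero_le_one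
        _ = 1 := one_mul _
    have hS : ∑ d₁ ∈ l.divisors, ∑ d₂ ∈ m.divisors, ∑ i ∈ nearBoxes q d₁ d₂ (L ^ 4),
        ((q * (r + 1) : ℕ) : ℝ) * ∑' h : ℤ × ℤ,
          (if (H₂f q d₁ d₂ (l / d₁) (m / d₂) (r + 1) i : ℤ) < |h.2| then
            ‖fourier2 (boxWeight q d₁ d₂ (l / d₁) (m / d₂) (r + 1) i) (h.1 / (q * (r + 1) : ℕ))
              (h.2 / (q * (r + 1) : ℕ))‖ else 0) ≤ (q : ℝ) * ((q : ℝ) * (121 * (q : ℝ) ^ 2 * B)) := by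
      have hd1sum : ∀ d₁ ∈ l.divisors, ∑ d₂ ∈ m.divisors, ∑ i ∈ nearBoxes q d₁ d₂ (L ^ 4),
          ((q * (r + 1) : ℕ) : ℝ) * ∑' h : ℤ × ℤ,
            (if (H₂f q d₁ d₂ (l / d₁) (m / d₂) (r + 1) i : ℤ) < |h.2| then
              ‖fourier2 (boxWeight q d₁ d₂ (l / d₁) (m / d₂) (r + 1) i) (h.1 / (q * (r + 1) : ℕ))
                (h.2 / (q * (r + 1) : ℕ))‖ else 0) ≤ (q : ℝ) * (121 * (q : ℝ) ^ 2 * B) := by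
        intro d₁ hd₁
        have hd2sum : ∀ d₂ ∈ m.divisors, ∑ i ∈ nearBoxes q d₁ d₂ (L ^ 4),
            ((q * (r + 1) : ℕ) : ℝ) * ∑' h : ℤ × ℤ,
              (if (H₂f q d₁ d₂ (l / d₁) (m / d₂) (r + 1) i : ℤ) < |h.2| then
                ‖fourier2 (boxWeight q d₁ d₂ (l / d₁) (m / d₂) (r + 1) i) (h.1 / (q * (r + 1) : ℕ))
                  (h.2 / (q * (r + 1) : ℕ))‖ else 0) ≤ 121 * (q : ℝ) ^ 2 * B := by
          intro d₂ hd₂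
          calc _ ≤ ((nearBoxes q d₁ d₂ (L ^ 4)).card : ℝ) * B := by
                rw [← nsmul_eq_mul]
                exact Finset.sum_le_card_nsmul _ _ _ fun i hi ↦ hbox r hr l hl m hm d₁ hd₁ d₂ hd₂ i hi
            _ ≤ 121 * (q : ℝ) ^ 2 * B :=
                mul_le_mul_of_nonneg_right (hnear (Nat.pos_of_mem_divisors hd₁) (Nat.pos_of_mem_divisors hd₂)) hB
        calc _ ≤ (m.divisors.card : ℝ) * (121 * (q : ℝ) ^ 2 * B) := by
              rw [← nsmul_eq_mul]; exact Finset.sum_le_card_nsmul _ _ _ hd2sum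
          _ ≤ (q : ℝ) * (121 * (q : ℝ) ^ 2 * B) := by
              refine mul_le_mul_of_nonneg_right ?_ (by positivity)
              exact le_trans (by exact_mod_cast Nat.card_divisors_le_self m) hmq
      calc _ ≤ (l.divisors.card : ℝ) * ((q : ℝ) * (121 * (q : ℝ) ^ 2 * B)) := by
            rw [← nsmul_eq_mul]; exact Finset.sum_le_card_nsmul _ _ _ hd1sum
        _ ≤ (q : ℝ) * ((q : ℝ) * (121 * (q : ℝ) ^ 2 * B)) := by
            refine mul_le_mul_of_nonneg_right ?_ (by positivity)
            exact le_trans (by exact_mod_cast Nat.card_divisors_le_self l) hlq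
    have hS0 : 0 ≤ ∑ d₁ ∈ l.divisors, ∑ d₂ ∈ m.divisors, ∑ i ∈ nearBoxes q d₁ d₂ (L ^ 4),
        ((q * (r + 1) : ℕ) : ℝ) * ∑' h : ℤ × ℤ,
          (if (H₂f q d₁ d₂ (l / d₁) (m / d₂) (r + 1) i : ℤ) < |h.2| then
            ‖fourier2 (boxWeight q d₁ d₂ (l / d₁) (m / d₂) (r + 1) i) (h.1 / (q * (r + 1) : ℕ))
              (h.2 / (q * (r + 1) : ℕ))‖ else 0) :=
      Finset.sum_nonneg fun _ _ ↦ Finset.sum_nonneg fun _ _ ↦ Finset.sum_nonneg fun _ _ ↦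
        mul_nonneg (Nat.cast_nonneg _) (tsum_nonneg fun h ↦ by split_ifs <;> positivity)
    calc _ ≤ 1 * ((q : ℝ) * ((q : ℝ) * (121 * (q : ℝ) ^ 2 * B))) := mul_le_mul hcc hS hS0 zero_le_one
      _ = _ := one_mul _
  -- the outer three sums
  have hcardI : ((Finset.Icc 1 ⌊M⌋₊).card : ℝ) ≤ q := by
    rw [Nat.card_Icc]; push_cast
    have : ((⌊M⌋₊ + 1 - 1 : ℕ) : ℝ) = ⌊M⌋₊ := by simp
    linarith [hfloor, this]
  have hm_sum : ∀ r ∈ Finset.range (q ^ 7), ∀ l ∈ Finset.Icc 1 ⌊M⌋₊,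
      ∑ m ∈ Finset.Icc 1 ⌊M⌋₊, |mollifierCoeff (X ^ 2) M l * mollifierCoeff (X ^ 2) M m| *
          ∑ d₁ ∈ l.divisors, ∑ d₂ ∈ m.divisors, ∑ i ∈ nearBoxes q d₁ d₂ (L ^ 4),
            ((q * (r + 1) : ℕ) : ℝ) * ∑' h : ℤ × ℤ,
              (if (H₂f q d₁ d₂ (l / d₁) (m / d₂) (r + 1) i : ℤ) < |h.2| then
                ‖fourier2 (boxWeight q d₁ d₂ (l / d₁) (m / d₂) (r + 1) i) (h.1 / (q * (r + 1) : ℕ))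
                  (h.2 / (q * (r + 1) : ℕ))‖ else 0) ≤
        (q : ℝ) * ((q : ℝ) * ((q : ℝ) * (121 * (q : ℝ) ^ 2 * B))) := by
    intro r hr l hl
    calc _ ≤ ((Finset.Icc 1 ⌊M⌋₊).card : ℝ) * ((q : ℝ) * ((q : ℝ) * (121 * (q : ℝ) ^ 2 * B))) := by
          rw [← nsmul_eq_mul]; exact Finset.sum_le_card_nsmul _ _ _ fun m hm ↦ hinner r hr l hl m hm
      _ ≤ _ := mul_le_mul_of_nonneg_right hcardI (by positivity)
  have hl_sum : ∀ r ∈ Finset.range (q ^ 7),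
      ∑ l ∈ Finset.Icc 1 ⌊M⌋₊, ∑ m ∈ Finset.Icc 1 ⌊M⌋₊,
        |mollifierCoeff (X ^ 2) M l * mollifierCoeff (X ^ 2) M m| *
          ∑ d₁ ∈ l.divisors, ∑ d₂ ∈ m.divisors, ∑ i ∈ nearBoxes q d₁ d₂ (L ^ 4),
            ((q * (r + 1) : ℕ) : ℝ) * ∑' h : ℤ × ℤ,
              (if (H₂f q d₁ d₂ (l / d₁) (m / d₂) (r + 1) i : ℤ) < |h.2| then
                ‖fourier2 (boxWeight q d₁ d₂ (l / d₁) (m / d₂) (r + 1) i) (h.1 / (q * (r + 1) : ℕ))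
                  (h.2 / (q * (r + 1) : ℕ))‖ else 0) ≤
        (q : ℝ) * ((q : ℝ) * ((q : ℝ) * ((q : ℝ) * (121 * (q : ℝ) ^ 2 * B)))) := by
    intro r hr
    calc _ ≤ ((Finset.Icc 1 ⌊M⌋₊).card : ℝ) * ((q : ℝ) * ((q : ℝ) * ((q : ℝ) * (121 * (q : ℝ) ^ 2 * B)))) := by
          rw [← nsmul_eq_mul]; exact Finset.sum_le_card_nsmul _ _ _ fun l hl ↦ hm_sum r hr l hl
      _ ≤ _ := mul_le_mul_of_nonneg_right hcardI (by positivity)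
  have hr_sum : ∑ r ∈ Finset.range (q ^ 7), ∑ l ∈ Finset.Icc 1 ⌊M⌋₊, ∑ m ∈ Finset.Icc 1 ⌊M⌋₊,
        |mollifierCoeff (X ^ 2) M l * mollifierCoeff (X ^ 2) M m| *
          ∑ d₁ ∈ l.divisors, ∑ d₂ ∈ m.divisors, ∑ i ∈ nearBoxes q d₁ d₂ (L ^ 4),
            ((q * (r + 1) : ℕ) : ℝ) * ∑' h : ℤ × ℤ,
              (if (H₂f q d₁ d₂ (l / d₁) (m / d₂) (r + 1) i : ℤ) < |h.2| then
                ‖fourier2 (boxWeight q d₁ d₂ (l / d₁) (m / d₂) (r + 1) i) (h.1 / (q * (r + 1) : ℕ))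
                  (h.2 / (q * (r + 1) : ℕ))‖ else 0) ≤
        ((q ^ 7 : ℕ) : ℝ) * ((q : ℝ) * ((q : ℝ) * ((q : ℝ) * ((q : ℝ) * (121 * (q : ℝ) ^ 2 * B))))) := by
    calc _ ≤ ((Finset.range (q ^ 7)).card : ℝ) *
          ((q : ℝ) * ((q : ℝ) * ((q : ℝ) * ((q : ℝ) * (121 * (q : ℝ) ^ 2 * B))))) := by
          rw [← nsmul_eq_mul]; exact Finset.sum_le_card_nsmul _ _ _ hl_sum
      _ = _ := by rw [Finset.card_range]
  have htot0 : 0 ≤ ∑ r ∈ Finset.range (q ^ 7), ∑ l ∈ Finset.Icc 1 ⌊M⌋₊, ∑ m ∈ Finset.Icc 1 ⌊M⌋₊,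
        |mollifierCoeff (X ^ 2) M l * mollifierCoeff (X ^ 2) M m| *
          ∑ d₁ ∈ l.divisors, ∑ d₂ ∈ m.divisors, ∑ i ∈ nearBoxes q d₁ d₂ (L ^ 4),
            ((q * (r + 1) : ℕ) : ℝ) * ∑' h : ℤ × ℤ,
              (if (H₂f q d₁ d₂ (l / d₁) (m / d₂) (r + 1) i : ℤ) < |h.2| then
                ‖fourier2 (boxWeight q d₁ d₂ (l / d₁) (m / d₂) (r + 1) i) (h.1 / (q * (r + 1) : ℕ))
                  (h.2 / (q * (r + 1) : ℕ))‖ else 0) :=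
    Finset.sum_nonneg fun _ _ ↦ Finset.sum_nonneg fun _ _ ↦ Finset.sum_nonneg fun _ _ ↦
      mul_nonneg (abs_nonneg _) (Finset.sum_nonneg fun _ _ ↦ Finset.sum_nonneg fun _ _ ↦
        Finset.sum_nonneg fun _ _ ↦ mul_nonneg (Nat.cast_nonneg _)
          (tsum_nonneg fun h ↦ by split_ifs <;> positivity))
  calc _ ≤ (4 * π) * (((q ^ 7 : ℕ) : ℝ) * ((q : ℝ) * ((q : ℝ) * ((q : ℝ) * ((q : ℝ) *
        (121 * (q : ℝ) ^ 2 * B)))))) := mul_le_mul hpre hr_sum htot0 (by positivity)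
    _ = 4 * π * (121 * (q : ℝ) ^ 13 * B) := by push_cast; ring

/-- **The two heights of the core are coordinatewise admissible** with `Λ₀* = max(Λ₀, 2/π)`: the first by
hypothesis, the second (`⌈q(r+1)·D₂·q^{ε₀}/(2π)⌉`) by `truncHeight_snd_le`. [folklore] -/
theorem coreHeights_admissible {q : ℕ} {Λ₀ ε₀ : ℝ} (Hf : ℕ → ℕ → ℕ → ℕ → ℕ → ℕ → ℕ × ℕ → ℕ)
    (hHf : ∀ d₁ d₂ α β c : ℕ, ∀ i : ℕ × ℕ, (Hf q d₁ d₂ α β c i : ℝ) ≤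
      Λ₀ * ((q : ℝ) * (c : ℝ) * (1 + 4 * π * Real.sqrt ((α : ℝ) * (β : ℝ) * ((2 : ℝ) ^ i.1 * 2 ^ i.2)) /
        ((q : ℝ) * (c : ℝ))) * (q : ℝ) ^ ε₀) / (2 : ℝ) ^ i.1 + 1)
    (r l m d₁ d₂ : ℕ) (i : ℕ × ℕ) :
    ((Hf q d₁ d₂ (l / d₁) (m / d₂) (r + 1) i : ℝ) ≤ max Λ₀ (2 / π) * ((q : ℝ) * ((r + 1 : ℕ) : ℝ) *
        (1 + 4 * π * Real.sqrt (((l / d₁ : ℕ) : ℝ) * ((m / d₂ : ℕ) : ℝ) * ((2 : ℝ) ^ i.1 * 2 ^ i.2)) /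
          ((q : ℝ) * ((r + 1 : ℕ) : ℝ))) * (q : ℝ) ^ ε₀) / (2 : ℝ) ^ i.1 + 1) ∧
    (((⌈((q * (r + 1) : ℕ) : ℝ) * ((1 + 4 * π * Real.sqrt (((m / d₂ : ℕ) : ℝ) * ((l / d₁ : ℕ) : ℝ) *
        (2 * 2 ^ i.1)) / ((q : ℝ) * ((r + 1 : ℕ) : ℝ)) * Real.sqrt (2 * 2 ^ i.2)) / ((2 : ℝ) ^ i.2 / 2)) /
        (2 * π) * (q : ℝ) ^ ε₀⌉₊ : ℕ) : ℝ) ≤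
      max Λ₀ (2 / π) * ((q : ℝ) * ((r + 1 : ℕ) : ℝ) *
        (1 + 4 * π * Real.sqrt (((l / d₁ : ℕ) : ℝ) * ((m / d₂ : ℕ) : ℝ) * ((2 : ℝ) ^ i.1 * 2 ^ i.2)) /
          ((q : ℝ) * ((r + 1 : ℕ) : ℝ))) * (q : ℝ) ^ ε₀) / (2 : ℝ) ^ i.2 + 1) := by
  have hW0 : 0 ≤ (q : ℝ) * ((r + 1 : ℕ) : ℝ) *
      (1 + 4 * π * Real.sqrt (((l / d₁ : ℕ) : ℝ) * ((m / d₂ : ℕ) : ℝ) * ((2 : ℝ) ^ i.1 * 2 ^ i.2)) /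
        ((q : ℝ) * ((r + 1 : ℕ) : ℝ))) * (q : ℝ) ^ ε₀ := by positivity
  constructor
  · refine (hHf d₁ d₂ (l / d₁) (m / d₂) (r + 1) i).trans (add_le_add ?_ le_rfl)
    exact div_le_div_of_nonneg_right (mul_le_mul_of_nonneg_right (le_max_left _ _) hW0) (by positivity)
  · have hD := truncHeight_snd_le (α := ((l / d₁ : ℕ) : ℝ)) (β := ((m / d₂ : ℕ) : ℝ)) (K₁ := (2 : ℝ) ^ i.1)
      (K₂ := (2 : ℝ) ^ i.2) (c := ((q * (r + 1) : ℕ) : ℝ)) (den := (q : ℝ) * ((r + 1 : ℕ) : ℝ))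
      (Q := (q : ℝ) ^ ε₀) (Nat.cast_nonneg _) (Nat.cast_nonneg _) (by positivity) (by positivity)
      (Nat.cast_nonneg _) (by positivity) (by positivity)
    have hcast : ((q * (r + 1) : ℕ) : ℝ) = (q : ℝ) * ((r + 1 : ℕ) : ℝ) := by push_cast; ring
    refine natCeil_le_add_one (by positivity) (hD.trans ?_)
    rw [hcast]
    exact div_le_div_of_nonneg_right (mul_le_mul_of_nonneg_right (le_max_right _ _) hW0) (by positivity)

/-- **K2 — the trivial size of exactly the finite dual core.** For `Λ₀ ≥ 0`, `0 < ε₀ ≤ 1`, `ε > 0` there is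
`q₀` such that for every prime `q ≥ q₀`, every `Δ′ ∈ (1, 2]` and every height function `Hf` that is
coordinatewise admissible at level `q`
(`Hf q d₁ d₂ α β c i ≤ Λ₀·qc·(1 + 4π√(αβ·2^{i₁}2^{i₂})/(qc))·q^{ε₀}/2^{i₁} + 1` for all indices — e.g. L2's
`⌈qc·D₁·q^{ε₀}/(2π)⌉` with `Λ₀ = 2/π`, `OffDiagDualLedgerMainScale.truncHeight_fst_le`):
`|offDiagCore Hf Δ′ q| ≤ q^{(5/4)(Δ′−1) + 2ε₀ + ε}·mainScaleReal Δ′ q`.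
The trivial exponent `κ₀ = 5/4`: what LIVE-Ω has to save on the lead's object by cancellation.
[cite: KowalskiMichelVanderKam2000, (21)–(23) p. 12, Lemma 3.3 p. 9, §6 p. 19; HardyWright2008, Thm. 315 — derivation] -/
theorem abs_offDiagCore_le {Λ₀ ε₀ ε : ℝ} (hΛ₀ : 0 ≤ Λ₀) (hε₀ : 0 < ε₀) (hε₁ : ε₀ ≤ 1) (hε : 0 < ε) :
    ∃ q₀ : ℕ, ∀ (q : ℕ) [NeZero q], q₀ ≤ q → q.Prime → ∀ Δ' : ℝ, 1 < Δ' → Δ' ≤ 2 →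
      ∀ Hf : ℕ → ℕ → ℕ → ℕ → ℕ → ℕ → ℕ × ℕ → ℕ,
        (∀ d₁ d₂ α β c : ℕ, ∀ i : ℕ × ℕ, (Hf q d₁ d₂ α β c i : ℝ) ≤
          Λ₀ * ((q : ℝ) * (c : ℝ) * (1 + 4 * π * Real.sqrt ((α : ℝ) * (β : ℝ) * ((2 : ℝ) ^ i.1 * 2 ^ i.2)) /
            ((q : ℝ) * (c : ℝ))) * (q : ℝ) ^ ε₀) / (2 : ℝ) ^ i.1 + 1) →
        |offDiagCore Hf Δ' q| ≤ (q : ℝ) ^ (5 / 4 * (Δ' - 1) + 2 * ε₀ + ε) * mainScaleReal Δ' q := by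
  -- the number of integrations by parts and the tail constant
  set k : ℕ := ⌈74 / ε₀⌉₊ + 2 with hk
  have hk2 : 2 ≤ k := by rw [hk]; omega
  have hkε : (74 : ℝ) ≤ ε₀ * k := by
    have h1 : (74 / ε₀ : ℝ) ≤ ⌈74 / ε₀⌉₊ := Nat.le_ceil _
    have h2 : (k : ℝ) = ⌈74 / ε₀⌉₊ + 2 := by rw [hk]; push_cast; ring
    rw [h2]
    have h3 : ε₀ * (74 / ε₀) = 74 := by field_simp
    nlinarith
  obtain ⟨𝓚, h𝓚0, hbox⟩ := exists_boxTail_snd_le hk2 hε₀.le hε₁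
  obtain ⟨q₁, hq₁⟩ := dualLedgerTotal_scales_le (Λ₀ := max Λ₀ (2 / π)) (hΛ₀.trans (le_max_left _ _))
    hε₀.le hε₁ (half_pos hε)
  obtain ⟨q₂, hq₂⟩ := PeterssonSplit.exists_qhat_rpow_le_mul_mainScaleReal (K := 4 * π * (121 * 𝓚))
    (by positivity) one_pos
  obtain ⟨q₃, hq₃⟩ := exists_mul_log_pow_le_rpow (K := 2) (by norm_num) (half_pos hε) 0
  refine ⟨max (max 40 q₁) (max q₂ q₃), ?_⟩
  intro q _ hq hprime Δ' h1 h2 Hf hHf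
  have hq40 : 40 ≤ q := le_trans (le_max_left _ _) (le_trans (le_max_left _ _) hq)
  have hqq₁ : q₁ ≤ q := le_trans (le_max_right _ _) (le_trans (le_max_left _ _) hq)
  have hqq₂ : q₂ ≤ q := le_trans (le_max_left _ _) (le_trans (le_max_right _ _) hq)
  have hqq₃ : q₃ ≤ q := le_trans (le_max_right _ _) (le_trans (le_max_right _ _) hq)
  have hq1n : 1 ≤ q := by omega
  have hq1 : (1 : ℝ) ≤ q := by exact_mod_cast hq1n
  have hq0 : (0 : ℝ) < q := by linarith
  have h0 : 0 < Δ' := lt_trans zero_lt_one h1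
  -- the split against ledger plus tail, second height `⌈q c D₂ q^{ε₀}/(2π)⌉`
  have hsplit := abs_offDiagCore_le_ledger_add_tail (q := q) Hf
    (fun q' d₁ d₂ α β c i ↦ ⌈((q' * c : ℕ) : ℝ) * ((1 + 4 * π * Real.sqrt ((β : ℝ) * α * (2 * 2 ^ i.1)) /
      ((q' : ℝ) * (c : ℝ)) * Real.sqrt (2 * 2 ^ i.2)) / ((2 : ℝ) ^ i.2 / 2)) / (2 * π) * (q' : ℝ) ^ ε₀⌉₊) Δ'
  rw [mul_add] at hsplit
  -- the ledger part
  have hL := hq₁ q hqq₁ hprime Δ' h1 h2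
    (fun r l m d₁ d₂ i ↦ (Hf q d₁ d₂ (l / d₁) (m / d₂) (r + 1) i,
      ⌈((q * (r + 1) : ℕ) : ℝ) * ((1 + 4 * π * Real.sqrt (((m / d₂ : ℕ) : ℝ) * ((l / d₁ : ℕ) : ℝ) *
        (2 * 2 ^ i.1)) / ((q : ℝ) * ((r + 1 : ℕ) : ℝ)) * Real.sqrt (2 * 2 ^ i.2)) / ((2 : ℝ) ^ i.2 / 2)) /
        (2 * π) * (q : ℝ) ^ ε₀⌉₊))
    (fun r l m d₁ d₂ i ↦ coreHeights_admissible Hf hHf r l m d₁ d₂ i)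
  -- the tail part
  have hB0 : 0 ≤ 𝓚 * (q : ℝ) ^ 61 * (((q : ℝ) ^ ε₀) ^ k)⁻¹ := by positivity
  have hfloorq : (⌊qhat q ^ Δ'⌋₊ : ℝ) ≤ q := by
    have hs1 : 1 < qhat q := one_lt_qhat hq40
    have hMq : qhat q ^ Δ' ≤ (q : ℝ) := by
      calc qhat q ^ Δ' ≤ qhat q ^ (2 : ℝ) := Real.rpow_le_rpow_of_exponent_le hs1.le h2
        _ = qhat q ^ 2 := by rw [show (2 : ℝ) = (2 : ℕ) by norm_num, Real.rpow_natCast]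
        _ ≤ q := qhat_sq_le q
    exact (Nat.floor_le (by positivity)).trans hMq
  have h4s : 4 * qhat q ^ 2 * Real.log q ^ 4 ≤ (q : ℝ) ^ 5 := by
    have h4 : 4 * qhat q ^ 2 ≤ (q : ℝ) := by
      rw [← two_pi_mul_qhat_sq q, show (2 * π * qhat q) ^ 2 = π ^ 2 * (4 * qhat q ^ 2) by ring]
      have hπ : (1 : ℝ) ≤ π ^ 2 := by nlinarith [Real.pi_gt_three]
      exact le_mul_of_one_le_left (by positivity) hπ
    have hL4 : Real.log q ^ 4 ≤ (q : ℝ) ^ 4 :=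
      pow_le_pow_left₀ (Real.log_nonneg hq1) ((Real.log_le_sub_one_of_pos hq0).trans (by linarith)) 4
    calc 4 * qhat q ^ 2 * Real.log q ^ 4 ≤ (q : ℝ) * (q : ℝ) ^ 4 :=
          mul_le_mul h4 hL4 (by positivity) (by positivity)
      _ = (q : ℝ) ^ 5 := by ring
  have hT := coreTail_count_le hq40 h0 h2
    (fun q' d₁ d₂ α β c i ↦ ⌈((q' * c : ℕ) : ℝ) * ((1 + 4 * π * Real.sqrt ((β : ℝ) * α * (2 * 2 ^ i.1)) /
      ((q' : ℝ) * (c : ℝ)) * Real.sqrt (2 * 2 ^ i.2)) / ((2 : ℝ) ^ i.2 / 2)) / (2 * π) * (q' : ℝ) ^ ε₀⌉₊)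
    hB0 (fun r hr l hl m hm d₁ hd₁ d₂ hd₂ i hi ↦ by
      have hl1 : 1 ≤ l := (Finset.mem_Icc.mp hl).1
      have hm1 : 1 ≤ m := (Finset.mem_Icc.mp hm).1
      have hd₁1 := Nat.pos_of_mem_divisors hd₁
      have hd₂1 := Nat.pos_of_mem_divisors hd₂
      have hfar := PeterssonSplit.not_far_of_mem_nearBoxes hi
      rw [not_le] at hfar
      have hd' : (1 : ℝ) ≤ (d₁ : ℝ) * d₂ := by exact_mod_cast Nat.mul_pos hd₁1 hd₂1
      have hKK : (2 : ℝ) ^ i.1 * 2 ^ i.2 ≤ (q : ℝ) ^ 5 := by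
        calc (2 : ℝ) ^ i.1 * 2 ^ i.2 = 2 ^ (i.1 + i.2) := (pow_add _ _ _).symm
          _ ≤ 2 ^ (i.1 + i.2) * ((d₁ : ℝ) * d₂) := le_mul_of_one_le_right (by positivity) hd'
          _ ≤ 4 * qhat q ^ 2 * Real.log q ^ 4 := hfar.le
          _ ≤ (q : ℝ) ^ 5 := h4s
      have hK₁1 : (1 : ℝ) ≤ (2 : ℝ) ^ i.1 := one_le_pow₀ (by norm_num)
      have hK₂1 : (1 : ℝ) ≤ (2 : ℝ) ^ i.2 := one_le_pow₀ (by norm_num)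
      have hK₁ : (2 : ℝ) ^ i.1 ≤ (q : ℝ) ^ 5 := (le_mul_of_one_le_right (by positivity) hK₂1).trans hKK
      have hK₂ : (2 : ℝ) ^ i.2 ≤ (q : ℝ) ^ 5 := (le_mul_of_one_le_left (by positivity) hK₁1).trans hKK
      have hαq : (((l / d₁ : ℕ) : ℕ) : ℝ) ≤ q :=
        le_trans (by exact_mod_cast (Nat.div_le_self l d₁).trans (Finset.mem_Icc.mp hl).2) hfloorq
      have hβq : (((m / d₂ : ℕ) : ℕ) : ℝ) ≤ q :=
        le_trans (by exact_mod_cast (Nat.div_le_self m d₂).trans (Finset.mem_Icc.mp hm).2) hfloorq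
      exact hbox q d₁ d₂ (l / d₁) (m / d₂) r i hq1n hd₁1 hd₂1
        (OffDiagDual.one_le_div_of_dvd (Nat.dvd_of_mem_divisors hd₁) hl1)
        (OffDiagDual.one_le_div_of_dvd (Nat.dvd_of_mem_divisors hd₂) hm1) hαq hβq
        (Nat.succ_le_of_lt (Finset.mem_range.mp hr)) hK₁ hK₂)
  -- the tail is `≤ ms`
  have hQk : (q : ℝ) ^ 74 ≤ ((q : ℝ) ^ ε₀) ^ k := by
    rw [← Real.rpow_natCast ((q : ℝ) ^ ε₀) k, ← Real.rpow_mul hq0.le, ← Real.rpow_natCast (q : ℝ) 74]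
    exact Real.rpow_le_rpow_of_exponent_le hq1 (by push_cast; linarith)
  have hTnum : 4 * π * (121 * (q : ℝ) ^ 13 * (𝓚 * (q : ℝ) ^ 61 * (((q : ℝ) ^ ε₀) ^ k)⁻¹)) ≤
      4 * π * (121 * 𝓚) := by
    have hQk0 : 0 < ((q : ℝ) ^ ε₀) ^ k := by positivity
    have hre : 121 * (q : ℝ) ^ 13 * (𝓚 * (q : ℝ) ^ 61 * (((q : ℝ) ^ ε₀) ^ k)⁻¹) =
        121 * 𝓚 * ((q : ℝ) ^ 74 / ((q : ℝ) ^ ε₀) ^ k) := by rw [div_eq_mul_inv]; ring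
    have hle1 : (q : ℝ) ^ 74 / ((q : ℝ) ^ ε₀) ^ k ≤ 1 := (div_le_one hQk0).mpr hQk
    rw [hre]
    calc 4 * π * (121 * 𝓚 * ((q : ℝ) ^ 74 / ((q : ℝ) ^ ε₀) ^ k)) ≤ 4 * π * (121 * 𝓚 * 1) := by gcongr
      _ = 4 * π * (121 * 𝓚) := by ring
  have hs1 : 1 ≤ qhat q := (one_lt_qhat hq40).le
  have hKms : 4 * π * (121 * 𝓚) ≤ mainScaleReal Δ' q := by
    have h := hq₂ q hqq₂ Δ' h0 h2
    rw [one_mul] at h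
    exact (le_mul_of_one_le_right (by positivity) (Real.one_le_rpow hs1 (by norm_num))).trans h
  have hT' := hT.trans (hTnum.trans hKms)
  -- assemble
  have hms0 : 0 ≤ mainScaleReal Δ' q := mainScaleReal_nonneg _ _
  have ha0 : 0 ≤ 5 / 4 * (Δ' - 1) + 2 * ε₀ + ε / 2 := by nlinarith
  have hqa : 1 ≤ (q : ℝ) ^ (5 / 4 * (Δ' - 1) + 2 * ε₀ + ε / 2) := Real.one_le_rpow hq1 ha0
  have h2q : (2 : ℝ) ≤ (q : ℝ) ^ (ε / 2) := by
    have := hq₃ q hqq₃; rwa [pow_zero, mul_one] at this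
  calc |offDiagCore Hf Δ' q| ≤ _ := hsplit
    _ ≤ (q : ℝ) ^ (5 / 4 * (Δ' - 1) + 2 * ε₀ + ε / 2) * mainScaleReal Δ' q + mainScaleReal Δ' q :=
        add_le_add hL hT'
    _ ≤ (q : ℝ) ^ (5 / 4 * (Δ' - 1) + 2 * ε₀ + ε / 2) * mainScaleReal Δ' q +
          (q : ℝ) ^ (5 / 4 * (Δ' - 1) + 2 * ε₀ + ε / 2) * mainScaleReal Δ' q :=
        add_le_add le_rfl (le_mul_of_one_le_left hms0 hqa)
    _ = 2 * ((q : ℝ) ^ (5 / 4 * (Δ' - 1) + 2 * ε₀ + ε / 2) * mainScaleReal Δ' q) := by ring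
    _ ≤ (q : ℝ) ^ (ε / 2) * ((q : ℝ) ^ (5 / 4 * (Δ' - 1) + 2 * ε₀ + ε / 2) * mainScaleReal Δ' q) :=
        mul_le_mul_of_nonneg_right h2q (by positivity)
    _ = (q : ℝ) ^ (5 / 4 * (Δ' - 1) + 2 * ε₀ + ε) * mainScaleReal Δ' q := by
        rw [← mul_assoc, ← Real.rpow_add hq0]; ring_nf

end Summit.Parity.GeneralizedHardyLittlewood.Theorems.BeyondDiagonalBeatsQuarter.OffDiag
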